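import Summits.NavierStokesRegularity.NavierStokesRegularity.Theorems.SqueezeCycleRecurrentLiouvilleGkRemovalCore
import Summits.NavierStokesRegularity.NavierStokesRegularity.Theorems.SqueezeCycleRecurrentLiouvilleGkInvariantOfTendsto
import Summits.NavierStokesRegularity.NavierStokesRegularity.Theorems.SqueezeCycleRecurrentLiouvilleGkIncrementTools
import Summits.NavierStokesRegularity.NavierStokesRegularity.Theorems.SqueezeCycleRecurrentLiouvilleGkWindowLeray
import HarnessLib

/-!
# Crux `RecurrentLiouville` (stmt-NavierStokesRegularity-1589), line `Sketch` (v6, Giga–Kohn harvest) —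
# stub S1 `stub_gkWindowIncrementRemoval`: window increment removal (final assembly)

Theorems-only file (no definitions, no named facts).  **Window increment removal.**  For every rate
`C` and bound `M < ⊤` there are `R > 0` and `δ > 0` such that a suitable weak solution `(u, p)` of
Navier–Stokes (`ν = 1`) on `ℝ³ × ℝ₋` with weak gradient `G`, Albritton–Barker quantity `𝐈 ≤ M` and
the Type-I rate `‖u(t,x)‖ ≤ C/√(−t)`, whose scaling-orbit increments
`∫_{(−2,−1)×B_R} ‖c u(c²t, cx) − u(t,x)‖² dx dt` are `≤ δ` for every scale factor `1 ≤ c ≤ √2`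
(`c² ≤ 2`), is regular at the space–time origin: a Type-I singularity model cannot be
"almost self-similar on a window" in this `L²` sense, uniformly over the class.

The assembly `stub_gkRemovalCore` (A–B compactness `stub_rlClassLimit` + KNSS `C¹_loc` limit of the
Oseen-mild representatives `exists_tendsto_of_typeI_seq_Ioo` + transfer of the origin singularity +
`exists_curl_ne_zero_of_isBackwardSingularPoint`) is fed the three landed sibling stubs:
S1a `stub_gkInvariantOfTendsto` (Fatou + continuity: vanishing increments make the pointwise limit
scale invariant on the window), S3(ii) `stub_gkIncrementTools.2` (a.e.-congruence of the increment
functional), S4 `stub_gkWindowLeray` (Leray's reduction on the window + Tsai 1998 Thm 1: a constant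
slice).

## References

* T.-P. Tsai, Arch. Rational Mech. Anal. 143 (1998), Thm 1. [Tsai1998]
* G. Koch, N. Nadirashvili, G. Seregin, V. Šverák, Acta Math. 203 (2009), Prop. 4.1, Lemma 6.1.
  [KochNadirashviliSereginSverak2009]
* D. Albritton, T. Barker, J. Math. Fluid Mech. 21 (2019), Lemma 2.2, Prop. 2.3, §3. [AlbrittonBarker2019]
-/

noncomputable section

-- the sub-problem namespace repeats the summit name (D-0017 layout `Summit.<S>.<P>.Theorems`)
set_option linter.dupNamespace false

namespace Summit.NavierStokesRegularity.NavierStokesRegularity.Theorems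

open MeasureTheory Set Function Filter Topology TopologicalSpace Metric
open Literature.Analysis Literature.Analysis.FluidPDE
open scoped NNReal ENNReal

/-- **Window increment removal** (registered stub S1 of crux stmt-NavierStokesRegularity-1589, line
Sketch v6).  For every rate `C` and bound `M < ⊤` there are `R > 0` and `δ > 0` such that a suitable
weak solution on `ℝ³ × ℝ₋` with weak gradient, `𝐈 ≤ M` and the rate, whose scaling-orbit increments
`∫_{(−2,−1)×B_R} ‖c u(c²t, cx) − u(t,x)‖²` are `≤ δ` for every `1 ≤ c`, `c² ≤ 2`, is regular at the
space–time origin. [cite: Tsai1998, Thm 1; AlbrittonBarker2019, Lemma 2.2, Prop. 2.3 and §3;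
KochNadirashviliSereginSverak2009, Lemma 6.1] -/
theorem stub_gkWindowIncrementRemoval :
    ∀ (C : ℝ) (M : ℝ≥0∞), M < ⊤ →
      ∃ R : ℝ, 0 < R ∧ ∃ δ : ℝ, 0 < δ ∧
        ∀ (u : ℝ → EuclideanSpace ℝ (Fin 3) → EuclideanSpace ℝ (Fin 3))
          (p : ℝ → EuclideanSpace ℝ (Fin 3) → ℝ)
          (G : ℝ → EuclideanSpace ℝ (Fin 3) → EuclideanSpace ℝ (Fin 3) →L[ℝ] EuclideanSpace ℝ (Fin 3)),
          IsSuitableWeakSolutionOn (slab (EuclideanSpace ℝ (Fin 3)) (Iio 0) isOpen_Iio) 1 0 u p →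
          HasWeakSpatialGradientOn (slab (EuclideanSpace ℝ (Fin 3)) (Iio 0) isOpen_Iio) u G →
          typeIBound (Iio (0 : ℝ) ×ˢ univ) u p G ≤ M →
          HasTypeITimeDecay C u →
          (∀ c : ℝ, 1 ≤ c → c ^ 2 ≤ 2 →
            ∫⁻ z in Ioo (-2 : ℝ) (-1) ×ˢ Metric.ball (0 : EuclideanSpace ℝ (Fin 3)) R,
              ‖nsRescale c u z.1 z.2 - u z.1 z.2‖ₑ ^ 2 ≤ ENNReal.ofReal δ) →
          ¬ IsBackwardSingularPoint u 0 :=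
  stub_gkRemovalCore stub_gkInvariantOfTendsto stub_gkIncrementTools.2 stub_gkWindowLeray

end Summit.NavierStokesRegularity.NavierStokesRegularity.Theorems

end
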